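import Summits.BirchSwinnertonDyer.BirchSwinnertonDyer.Theorems.PrintCf2RamifiedOffTYZEvenSquareFormLevelOne
import HarnessLib

/-!
# Crux `PrintCf2.RamifiedOffTYZOfFacts` (stmt-BirchSwinnertonDyer-20509), line `offtyz-v7`, LEAD cycle 14 (cruxlead-20509 g13):
# THE EVEN SQUARE FORM, LEVEL TWO — the chains `n → d_W (≡ 7) → d_T (≡ 5)`

THEOREMS ONLY (no `def`, no named fact, no `sorry`), `--supports stmt-BirchSwinnertonDyer-20509` (C⁺ = item 23431 even sector; the `s = 1` even
stratum of 23432).  Part of the CLOSED-FORM REDUCTION behind the EVEN Ω-IDENTITY (crux workfiles `Lines/offtyz_v7_EvenOmega.lean`,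
`Lines/offtyz_v7_RegimeFreeLaw.md` §5b; definitions `…EvenOmegaDefs`): for `n = 2p₁⋯p_k ≡ 6 (mod 8)` and EVERY automorphism `g` of `ℍ′_n`, the
`τ(1)`-coefficient of `g·g·P(n) − P(n)` in g8's even square formula `SquareSilenceEven.galPt_mul_self_P_eq_add_even` (p703022), read modulo `2`,
is an explicit `𝔽₂`-form in the bits of `g` indexed on the prime tuple — block laws of `…EvenSquareFormBlocks` (regime-free), cofactor parities as
Monsky determinants, and the recursion indices converted to sub-tuples level by level.  BSD is not proved by any of this; no class is closed here.
* §4 `not_five_mem_recursionIndex_two_mul` (no block `≡ 5` directly under an even block), `blockProd_mem_recursionIndex_iff_seven`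
  (`d_W ∈ R(n) ⟺ d_W ≡ 7`), `blockProd_mem_recursionIndex_blockProd_iff` (`d_T ∈ R(d_W) ⟺ T ⊊ W`), the inner sum as a sum over `T`, quotient and
  residue bookkeeping, and `levelTwo_eq_sum_blocks`: level 2 `= Σ_{T : d_T ≡ 5} (Σ_{W ⊋ T, d_W ≡ 7} det M_even(Wᶜ)·det M_odd(W∖T))·ι-form(d_T)`.

References: [cite: TianYuanZhang2017, Thm. 1.1, §3.1 (p0011 L1–L13, L53–L73), Prop. 3.2 (1)(2), Thm. 3.6 (1)(2), proof of Lemma 3.21 (p0020 L27–L63)];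
[cite: HeathBrown1994SelmerCongruentII, Appendix (Monsky), typescript p. 39 L10 – p. 41 L36]; [cite: Smith2016CongruentDensity, Thm. 2.2 rows 1–3];
[cite: Cox2013, §5.C Lemma 5.19, §7.D, §9.A].
-/

noncomputable section

open scoped Classical NumberField

open WeierstrassCurve WeierstrassCurve.Affine Finset Matrix Literature.NumberTheory.EllipticCurves
  Literature.NumberTheory.EllipticCurves.TianYuanZhang2017
  Literature.NumberTheory.EllipticCurves.TianYuanZhang2017.W2
  Literature.NumberTheory.EllipticCurves.HeathBrown1994
  Literature.NumberTheory.EllipticCurves.HeathBrown1994.Families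
  Literature.NumberTheory.EllipticCurves.Smith2016
  Literature.NumberTheory.EllipticCurves.MonskySelmerParity
  Literature.NumberTheory.QuadraticFields.RingClass
  Literature.NumberTheory.QuadraticFields
  Literature.LinearAlgebra.Matrix
  Summit.BirchSwinnertonDyer.Rank1Residual.P2.GenusPeriodTransferLayer
  Summit.BirchSwinnertonDyer.Rank1Residual.P2.ThetaDescent
  Summit.BirchSwinnertonDyer.PrintCf2.QForm

set_option autoImplicit false

namespace Summit.BirchSwinnertonDyer.PrintCf2.MoverAssembly

variable {k : ℕ} (p : Fin k → ℕ) (hp : ∀ i, (p i).Prime) (hodd : ∀ i, Odd (p i)) (hinj : Function.Injective p)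

variable {n : ℕ} (D : GenusPointData n)

/-! ## §4 Level two: `n → d_W (≡ 7) → d_T (≡ 5)` -/

/-- **No block `≡ 5 (mod 8)` sits directly under an even block `2m`, `m ≡ 3 (mod 4)`** (the quotient would be `≡ 6 (mod 8)`).
[cite: TianYuanZhang2017, §3.1 (p0011 L67–L73)] -/
theorem not_five_mem_recursionIndex_two_mul {m d' : ℕ} (hm : m % 4 = 3) (hd' : d' ∈ recursionIndex (2 * m)) (h5 : d' % 8 = 5) :
    False := by
  obtain ⟨hdiv, -, h123, -⟩ := mem_recursionIndex_iff.mp hd'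
  have hdvd : d' ∣ 2 * m := Nat.dvd_of_mem_divisors hdiv
  have hodd' : Odd d' := Nat.odd_iff.mpr (by omega)
  have hcop : Nat.Coprime d' 2 := ((Nat.Prime.coprime_iff_not_dvd Nat.prime_two).mpr hodd'.not_two_dvd_nat).symm
  have hdm : d' ∣ m := hcop.dvd_of_dvd_mul_left hdvd
  obtain ⟨e, he⟩ := hdm
  have hq : 2 * m / d' = 2 * e := by
    rw [he, show 2 * (d' * e) = d' * (2 * e) by ring]; exact Nat.mul_div_cancel_left _ (by omega)
  rw [hq] at h123
  have hmod := Nat.mul_mod d' e 4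
  rw [← he, hm, show d' % 4 = 1 by omega, one_mul, Nat.mod_mod] at hmod
  omega

include hp hodd in
/-- **Membership of an odd block in `R(n)`**: `d_W ∈ recursionIndex n` iff `d_W ≡ 7 (mod 8)` (`n = 2p₁⋯p_k`, `∏pᵢ ≡ 3 (mod 4)`; the quotient `2d_{Wᶜ}`
is then `≡ 2 (mod 8)` automatically). [cite: TianYuanZhang2017, §3.1 (p0011 L67–L73), Thm. 3.6] -/
theorem blockProd_mem_recursionIndex_iff_seven (hn : n = 2 * ∏ i, p i) (h3 : (∏ i, p i) % 4 = 3) (W : Finset (Fin k)) :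
    ∏ i ∈ W, p i ∈ recursionIndex n ↔ (∏ i ∈ W, p i) % 8 = 7 := by
  have hoddW : Odd (∏ i ∈ W, p i) := by
    rw [← prod_blockPrimes p W]; exact odd_prod _ (blockPrimes_prime p hp W) (ne_two_of_odd _ (blockPrimes_odd p hodd W))
  have hdiv : n / ∏ i ∈ W, p i = 2 * ∏ i ∈ Wᶜ, p i := by
    rw [hn, ← Finset.prod_mul_prod_compl W p, show 2 * ((∏ i ∈ W, p i) * ∏ i ∈ Wᶜ, p i) = (∏ i ∈ W, p i) * (2 * ∏ i ∈ Wᶜ, p i) by ring]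
    exact Nat.mul_div_cancel_left _ (blockProd_pos p hp W)
  have hsplit : (∏ j ∈ W, p j) * (∏ j ∈ Wᶜ, p j) = ∏ i, p i := Finset.prod_mul_prod_compl W p
  have hmod := Nat.mul_mod (∏ j ∈ W, p j) (∏ j ∈ Wᶜ, p j) 4
  rw [hsplit, h3] at hmod
  constructor
  · intro hmem
    obtain ⟨-, h567, -, -⟩ := mem_recursionIndex_iff.mp hmem
    rcases h567 with h5 | h6 | h7
    · exact absurd hmem (blockProd_not_mem_recursionIndex_of_five p hp hn h3 W h5)
    · rcases hoddW with ⟨r, hr⟩; omega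
    · exact h7
  · intro h7
    have hc1 : (∏ j ∈ Wᶜ, p j) % 4 = 1 := by
      rw [show (∏ j ∈ W, p j) % 4 = 3 by omega] at hmod; omega
    refine mem_recursionIndex_iff.mpr ⟨?_, Or.inr (Or.inr h7), ?_, ?_⟩
    · rw [hn]
      exact Nat.mem_divisors.mpr ⟨Dvd.dvd.mul_left (Finset.prod_dvd_prod_of_subset _ _ _ (subset_univ W)) 2,
        mul_ne_zero two_ne_zero (Finset.prod_ne_zero_iff.mpr fun i _ => (hp i).ne_zero)⟩
    · rw [hdiv]; omega
    · rw [hdiv]; have := blockProd_pos p hp Wᶜ; omega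

include hp hinj in
/-- **Membership of `d_T ≡ 5` in `R(d_W)`, `d_W ≡ 7`**: iff `T ⊊ W` (the quotient `d_{W∖T}` is `≡ 3 (mod 8)` automatically).
[cite: TianYuanZhang2017, §3.1 (p0011 L67–L73)] -/
theorem blockProd_mem_recursionIndex_blockProd_iff (W T : Finset (Fin k)) (h7 : (∏ i ∈ W, p i) % 8 = 7) (h5 : (∏ i ∈ T, p i) % 8 = 5) :
    ∏ i ∈ T, p i ∈ recursionIndex (∏ i ∈ W, p i) ↔ T ⊆ W ∧ T ≠ W := by
  constructor
  · intro hmem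
    obtain ⟨hdiv, -, -, hgt⟩ := mem_recursionIndex_iff.mp hmem
    have hTW : T ⊆ W := (blockProd_dvd_blockProd_iff p hp hinj T W).mp (Nat.dvd_of_mem_divisors hdiv)
    refine ⟨hTW, ?_⟩
    rintro rfl
    rw [Nat.div_self (blockProd_pos p hp T)] at hgt; exact lt_irrefl 1 hgt
  · rintro ⟨hTW, hne⟩
    have hdvd : (∏ i ∈ T, p i) ∣ (∏ i ∈ W, p i) := (blockProd_dvd_blockProd_iff p hp hinj T W).mpr hTW
    have hq : (∏ i ∈ W, p i) / (∏ i ∈ T, p i) = ∏ i ∈ W \ T, p i := by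
      rw [← Finset.prod_sdiff hTW, mul_comm]; exact Nat.mul_div_cancel_left _ (blockProd_pos p hp T)
    have hsplit : (∏ i ∈ W \ T, p i) * (∏ i ∈ T, p i) = ∏ i ∈ W, p i := Finset.prod_sdiff hTW
    have hmod := Nat.mul_mod (∏ i ∈ W \ T, p i) (∏ i ∈ T, p i) 8
    rw [hsplit, h7, h5] at hmod
    have h3' : (∏ i ∈ W \ T, p i) % 8 = 3 := by omega
    refine mem_recursionIndex_iff.mpr ⟨Nat.mem_divisors.mpr ⟨hdvd, (blockProd_pos p hp W).ne'⟩, Or.inl h5, ?_, ?_⟩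
    · rw [hq]; exact Or.inr (Or.inr h3')
    · rw [hq]
      have hne' : (W \ T).Nonempty := Finset.sdiff_nonempty.mpr (fun h => hne (Finset.Subset.antisymm hTW h))
      obtain ⟨i, hi⟩ := hne'
      rw [← Finset.mul_prod_erase _ _ hi]
      have h1' := (hp i).one_lt
      have h2' := blockProd_pos p hp ((W \ T).erase i)
      nlinarith

include hp hodd hinj in
/-- **The inner sum over `R(d_W) ∩ {≡ 5}` as a sum over sub-tuples `T ⊊ W`** (`n = 2p₁⋯p_k`, `d_W ≡ 7 (mod 8)`).
[cite: TianYuanZhang2017, §3.1 (p0011 L67–L73)] -/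
theorem sum_recursionIndex_blockProd_five (hn : n = 2 * ∏ i, p i) (W : Finset (Fin k)) (h7 : (∏ i ∈ W, p i) % 8 = 7)
    {M : Type*} [AddCommMonoid M] (f : ℕ → M) :
    ∑ d' ∈ (recursionIndex (∏ i ∈ W, p i)).filter (fun d' => d' % 8 = 5), f d' =
      ∑ T : Finset (Fin k), if T ⊆ W ∧ T ≠ W ∧ (∏ i ∈ T, p i) % 8 = 5 then f (∏ i ∈ T, p i) else 0 := by
  have hn0 : n ≠ 0 := by rw [hn]; exact mul_ne_zero two_ne_zero (Finset.prod_ne_zero_iff.mpr fun i _ => (hp i).ne_zero)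
  have hWn : (∏ i ∈ W, p i) ∣ n := by rw [hn]; exact Dvd.dvd.mul_left (Finset.prod_dvd_prod_of_subset _ _ _ (subset_univ W)) 2
  have hsub : (recursionIndex (∏ i ∈ W, p i)).filter (fun d' => d' % 8 = 5) ⊆ n.divisors := fun d hd =>
    Nat.mem_divisors.mpr ⟨(Nat.dvd_of_mem_divisors (Finset.mem_filter.mp (Finset.mem_filter.mp hd).1).1).trans hWn, hn0⟩
  rw [show (∑ d' ∈ (recursionIndex (∏ i ∈ W, p i)).filter (fun d' => d' % 8 = 5), f d') =
      ∑ d' ∈ n.divisors ∩ (recursionIndex (∏ i ∈ W, p i)).filter (fun d' => d' % 8 = 5), f d' by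
        rw [Finset.inter_eq_right.mpr hsub], ← Finset.sum_ite_mem, sum_divisors_two_mul p hp hodd hinj hn]
  have heven0 : (∑ T : Finset (Fin k), if 2 * ∏ i ∈ T, p i ∈ (recursionIndex (∏ i ∈ W, p i)).filter (fun d' => d' % 8 = 5)
      then f (2 * ∏ i ∈ T, p i) else 0) = 0 := by
    refine Finset.sum_eq_zero fun T _ => ?_
    rw [if_neg]
    intro h
    have := (Finset.mem_filter.mp h).2
    omega
  rw [heven0, add_zero]
  refine Finset.sum_congr rfl fun T _ => ?_
  by_cases h5 : (∏ i ∈ T, p i) % 8 = 5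
  · by_cases hTW : T ⊆ W ∧ T ≠ W
    · rw [if_pos (Finset.mem_filter.mpr ⟨(blockProd_mem_recursionIndex_blockProd_iff p hp hinj W T h7 h5).mpr hTW, h5⟩),
        if_pos ⟨hTW.1, hTW.2, h5⟩]
    · rw [if_neg (show ¬ (∏ i ∈ T, p i ∈ (recursionIndex (∏ i ∈ W, p i)).filter (fun d' => d' % 8 = 5)) from
          fun h => hTW ((blockProd_mem_recursionIndex_blockProd_iff p hp hinj W T h7 h5).mp (Finset.mem_filter.mp h).1)),
        if_neg (show ¬ (T ⊆ W ∧ T ≠ W ∧ (∏ i ∈ T, p i) % 8 = 5) from fun h => hTW ⟨h.1, h.2.1⟩)]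
  · rw [if_neg (show ¬ (∏ i ∈ T, p i ∈ (recursionIndex (∏ i ∈ W, p i)).filter (fun d' => d' % 8 = 5)) from
        fun h => h5 (Finset.mem_filter.mp h).2),
      if_neg (show ¬ (T ⊆ W ∧ T ≠ W ∧ (∏ i ∈ T, p i) % 8 = 5) from fun h => h5 h.2.2)]

include hp in
/-- `n / d_W = 2d_{Wᶜ}` for `n = 2p₁⋯p_k`. [folklore] -/
theorem div_blockProd_eq_two_mul_compl (hn : n = 2 * ∏ i, p i) (W : Finset (Fin k)) : n / ∏ i ∈ W, p i = 2 * ∏ i ∈ Wᶜ, p i := by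
  rw [hn, ← Finset.prod_mul_prod_compl W p, show 2 * ((∏ i ∈ W, p i) * ∏ i ∈ Wᶜ, p i) = (∏ i ∈ W, p i) * (2 * ∏ i ∈ Wᶜ, p i) by ring]
  exact Nat.mul_div_cancel_left _ (blockProd_pos p hp W)

include hp in
/-- `2d_S / d_W = 2d_{S∖W}` for `W ⊆ S`. [folklore] -/
theorem two_mul_blockProd_div_blockProd {S W : Finset (Fin k)} (h : W ⊆ S) :
    (2 * ∏ i ∈ S, p i) / ∏ i ∈ W, p i = 2 * ∏ i ∈ S \ W, p i := by
  rw [← Finset.prod_sdiff h, show 2 * ((∏ i ∈ S \ W, p i) * ∏ i ∈ W, p i) = (∏ i ∈ W, p i) * (2 * ∏ i ∈ S \ W, p i) by ring]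
  exact Nat.mul_div_cancel_left _ (blockProd_pos p hp W)

include hp in
/-- `d_W / d_T = d_{W∖T}` for `T ⊆ W`. [folklore] -/
theorem blockProd_div_blockProd {W T : Finset (Fin k)} (h : T ⊆ W) : (∏ i ∈ W, p i) / ∏ i ∈ T, p i = ∏ i ∈ W \ T, p i := by
  rw [← Finset.prod_sdiff h, mul_comm]; exact Nat.mul_div_cancel_left _ (blockProd_pos p hp T)

/-- Residue bookkeeping `7 = 5 · 3`: `d_{W∖T} ≡ 3 (mod 8)` for `T ⊆ W`, `d_W ≡ 7`, `d_T ≡ 5`. [folklore] -/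
theorem sdiff_mod_eight_three {W T : Finset (Fin k)} (h : T ⊆ W) (h7 : (∏ i ∈ W, p i) % 8 = 7) (h5 : (∏ i ∈ T, p i) % 8 = 5) :
    (∏ i ∈ W \ T, p i) % 8 = 3 := by
  have hsplit : (∏ i ∈ W \ T, p i) * (∏ i ∈ T, p i) = ∏ i ∈ W, p i := Finset.prod_sdiff h
  have hmod := Nat.mul_mod (∏ i ∈ W \ T, p i) (∏ i ∈ T, p i) 8
  rw [hsplit, h7, h5] at hmod
  omega

/-- Residue bookkeeping `3 = 3 · 1 (mod 4)`: `d_{S∖W} ≡ 1 (mod 4)` for `W ⊆ S`, `d_S ≡ d_W ≡ 3 (mod 4)`. [folklore] -/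
theorem sdiff_mod_four_one {S W : Finset (Fin k)} (h : W ⊆ S) (hS : (∏ i ∈ S, p i) % 4 = 3) (hW : (∏ i ∈ W, p i) % 4 = 3) :
    (∏ i ∈ S \ W, p i) % 4 = 1 := by
  have hsplit : (∏ i ∈ S \ W, p i) * (∏ i ∈ W, p i) = ∏ i ∈ S, p i := Finset.prod_sdiff h
  have hmod := Nat.mul_mod (∏ i ∈ S \ W, p i) (∏ i ∈ W, p i) 4
  rw [hsplit, hS, hW] at hmod
  omega

include hp hodd hinj in
/-- **Level 2 as a form.**  `Σ_{d∈R(n)} Σ_{d′∈R(d), d′≡5} |𝓛(n/d)||𝓛(d/d′)|·ι(d′) ≡ Σ_{T : d_T ≡ 5} (Σ_{W ⊋ T, d_W ≡ 7} det M_even(Wᶜ)·det M_odd(W∖T))·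
(1 + x_im + Σ_t x_{q_t})·(ρ^T·x_T) (mod 2)` (only odd members `d_W ≡ 7` of `R(n)` carry blocks `≡ 5` below them).
[cite: TianYuanZhang2017, Thm. 1.1, §3.1 (p0011 L67–L73), Thm. 3.6 (1), proof of Lemma 3.21] [cite: HeathBrown1994SelmerCongruentII, Appendix (Monsky)] -/
theorem levelTwo_eq_sum_blocks (hn : n = 2 * ∏ i, p i) (h3 : (∏ i, p i) % 4 = 3) (hLs : D.scriptLSpec) (h11 : thm11_parity_of_scriptL)
    {zf : ℕ → APoint D.H} {Φf : ℕ → Finset (D.H ≃ₐ[ℚ] D.H)} {ΓHf ΓH'f : ℕ → Subgroup (D.H ≃ₐ[ℚ] D.H)}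
    {σf θf : ℕ → (D.H ≃ₐ[ℚ] D.H)} {cf : D.H ≃ₐ[ℚ] D.H}
    {ρ₂ : (d : ℕ) → (D.galK d →* RingClassGroup (GenusField d) 2)}
    {ρ₄ : (d : ℕ) → (D.galK d →* RingClassGroup (GenusField d) 4)}
    (hb : ∀ d ∈ n.divisors,
      ((d % 8 = 5 ∨ d % 8 = 6) → D.CMBlockSpec d (zf d) (Φf d) (ΓHf d) (ΓH'f d) (σf d) cf) ∧
      (d % 8 = 6 → D.ThetaBlockSpec d (zf d) (ΓHf d) (ΓH'f d) (σf d) (θf d)) ∧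
      (d % 8 = 7 → D.SevenBlockSpec d) ∧
      (d % 8 = 5 → D.RingClassTwoBlockSpec d (ΓHf d) (ΓH'f d) (ρ₂ d)) ∧
      (d % 8 = 6 → D.RingClassFourBlockSpec d (ΓHf d) (ΓH'f d) (ρ₄ d)) ∧
      (d % 8 = 5 → D.FrobeniusTwoBlockSpec d (ΓH'f d)) ∧
      (d % 8 = 6 → D.FrobeniusFourBlockSpec d (ΓH'f d)) ∧
      (d % 8 = 6 → D.FrobeniusFourValueBlockSpec d (ΓH'f d) (ρ₄ d)))
    (g : D.H ≃ₐ[ℚ] D.H) :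
    ((∑ d ∈ recursionIndex n, ∑ d' ∈ (recursionIndex d).filter (fun d' => d' % 8 = 5),
        (D.scriptL (n / d)).natAbs * (D.scriptL (d / d')).natAbs *
          (if (d' % 8 = 5 ∨ d' % 8 = 6) ∧ g (D.sqrtNeg d') = D.sqrtNeg d' ∧ (g * g) ^ gK d' * (σf d')⁻¹ ∈ ΓH'f d' then 1 else 0) : ℕ) :
        ZMod 2) =
      ∑ T : Finset (Fin k), if (∏ i ∈ T, p i) % 8 = 5 then
        (∑ W : Finset (Fin k), if T ⊆ W ∧ T ≠ W ∧ (∏ i ∈ W, p i) % 8 = 7 then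
            (monskyMatrixEven (blockPrimes p Wᶜ)).det * (monskyMatrixOdd (blockPrimes p (W \ T))).det else 0) *
          ((1 + (if g D.im = D.im then (0 : ZMod 2) else 1) +
              ∑ t : Fin T.card, (if g (D.im * D.sqrtNeg (blockPrimes p T t)) = D.im * D.sqrtNeg (blockPrimes p T t) then (0 : ZMod 2) else 1)) *
            ∑ i ∈ T, blockRho p T i * (if g (D.im * D.sqrtNeg (p i)) = D.im * D.sqrtNeg (p i) then (0 : ZMod 2) else 1))
      else 0 := by
  subst hn
  set ι : ℕ → ℕ := fun d =>
    if (d % 8 = 5 ∨ d % 8 = 6) ∧ g (D.sqrtNeg d) = D.sqrtNeg d ∧ (g * g) ^ gK d * (σf d)⁻¹ ∈ ΓH'f d then 1 else 0 with hι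
  set FP : Finset (Fin k) → ZMod 2 := fun T =>
    (1 + (if g D.im = D.im then (0 : ZMod 2) else 1) +
        ∑ t : Fin T.card, (if g (D.im * D.sqrtNeg (blockPrimes p T t)) = D.im * D.sqrtNeg (blockPrimes p T t) then (0 : ZMod 2) else 1)) *
      ∑ i ∈ T, blockRho p T i * (if g (D.im * D.sqrtNeg (p i)) = D.im * D.sqrtNeg (p i) then (0 : ZMod 2) else 1) with hFP
  have hιT : ∀ T : Finset (Fin k), (∏ i ∈ T, p i) % 8 = 5 → ((ι (∏ i ∈ T, p i) : ℕ) : ZMod 2) = FP T := fun T hT =>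
    iota_five_eq_form p hp hodd hinj D rfl T hT hb g
  set L : ℕ → ℕ := fun x => (D.scriptL x).natAbs with hL
  -- Step 1 (in ℕ): only the odd members `d_W ≡ 7` of `R(n)` carry blocks `≡ 5`, and those are the `d_T`, `T ⊊ W`
  have key : (∑ d ∈ recursionIndex (2 * ∏ i, p i), ∑ d' ∈ (recursionIndex d).filter (fun d' => d' % 8 = 5),
      L ((2 * ∏ i, p i) / d) * L (d / d') * ι d') =
      ∑ W : Finset (Fin k), if (∏ i ∈ W, p i) % 8 = 7 then
        ∑ T : Finset (Fin k), if T ⊆ W ∧ T ≠ W ∧ (∏ i ∈ T, p i) % 8 = 5 then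
          L (2 * ∏ i ∈ Wᶜ, p i) * L (∏ i ∈ W \ T, p i) * ι (∏ i ∈ T, p i) else 0 else 0 := by
    rw [sum_recursionIndex_eq_sum_ite, sum_divisors_two_mul p hp hodd hinj rfl]
    -- even members carry nothing
    have heven0 : (∑ S : Finset (Fin k), if 2 * ∏ i ∈ S, p i ∈ recursionIndex (2 * ∏ i, p i) then
        ∑ d' ∈ (recursionIndex (2 * ∏ i ∈ S, p i)).filter (fun d' => d' % 8 = 5),
          L ((2 * ∏ i, p i) / (2 * ∏ i ∈ S, p i)) * L ((2 * ∏ i ∈ S, p i) / d') * ι d' else 0) = 0 := by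
      refine Finset.sum_eq_zero fun S _ => ?_
      by_cases hmem : 2 * ∏ i ∈ S, p i ∈ recursionIndex (2 * ∏ i, p i)
      · rw [if_pos hmem]
        have hS4 := blockProd_mod_four_of_compl_one p h3 S ((two_mul_blockProd_mem_recursionIndex_iff p hp hodd rfl h3 S).mp hmem).1
        refine Finset.sum_eq_zero fun d' hd' => ?_
        obtain ⟨hd'r, hd'5⟩ := Finset.mem_filter.mp hd'
        exact (not_five_mem_recursionIndex_two_mul hS4 hd'r hd'5).elim
      · rw [if_neg hmem]
    rw [heven0, add_zero]
    refine Finset.sum_congr rfl fun W _ => ?_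
    by_cases hmem : ∏ i ∈ W, p i ∈ recursionIndex (2 * ∏ i, p i)
    · have h7 := (blockProd_mem_recursionIndex_iff_seven p hp hodd rfl h3 W).mp hmem
      rw [if_pos hmem, if_pos h7, sum_recursionIndex_blockProd_five p hp hodd hinj rfl W h7, div_blockProd_eq_two_mul_compl p hp rfl W]
      refine Finset.sum_congr rfl fun T _ => ?_
      by_cases hc : T ⊆ W ∧ T ≠ W ∧ (∏ i ∈ T, p i) % 8 = 5
      · rw [if_pos hc, if_pos hc, blockProd_div_blockProd p hp hc.1]
      · rw [if_neg hc, if_neg hc]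
    · have h7 : ¬ (∏ i ∈ W, p i) % 8 = 7 := fun h => hmem ((blockProd_mem_recursionIndex_iff_seven p hp hodd rfl h3 W).mpr h)
      rw [if_neg hmem, if_neg h7]
  rw [key]
  -- Step 2: cast, convert the coefficients and the block indicators, and swap the two sums
  simp only [Nat.cast_sum, Nat.cast_ite, Nat.cast_mul, Nat.cast_zero]
  have hterm : ∀ W T : Finset (Fin k),
      (if (∏ i ∈ W, p i) % 8 = 7 then
        (if T ⊆ W ∧ T ≠ W ∧ (∏ i ∈ T, p i) % 8 = 5 then
          ((L (2 * ∏ i ∈ Wᶜ, p i) : ℕ) : ZMod 2) * ((L (∏ i ∈ W \ T, p i) : ℕ) : ZMod 2) * ((ι (∏ i ∈ T, p i) : ℕ) : ZMod 2) else 0) else 0) =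
      if (∏ i ∈ T, p i) % 8 = 5 then
        (if T ⊆ W ∧ T ≠ W ∧ (∏ i ∈ W, p i) % 8 = 7 then
          (monskyMatrixEven (blockPrimes p Wᶜ)).det * (monskyMatrixOdd (blockPrimes p (W \ T))).det else 0) * FP T else 0 := by
    intro W T
    by_cases h7 : (∏ i ∈ W, p i) % 8 = 7
    · by_cases h5 : (∏ i ∈ T, p i) % 8 = 5
      · by_cases hTW : T ⊆ W ∧ T ≠ W
        · have hWc : (∏ i ∈ Wᶜ, p i) % 4 = 1 := by
            have hsplit : (∏ j ∈ W, p j) * (∏ j ∈ Wᶜ, p j) = ∏ i, p i := Finset.prod_mul_prod_compl W p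
            have hmod := Nat.mul_mod (∏ j ∈ W, p j) (∏ j ∈ Wᶜ, p j) 4
            rw [hsplit, h3, show (∏ j ∈ W, p j) % 4 = 3 by omega] at hmod; omega
          have hne : (W \ T).Nonempty := Finset.sdiff_nonempty.mpr (fun h => hTW.2 (Finset.Subset.antisymm hTW.1 h))
          rw [if_pos h7, if_pos ⟨hTW.1, hTW.2, h5⟩, if_pos h5, if_pos ⟨hTW.1, hTW.2, h7⟩, hL]
          simp only []
          rw [scriptL_natAbs_two_mul_blockProd_eq_det p hp hodd hinj D h11 rfl hLs Wᶜ hWc,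
            scriptL_natAbs_blockProd_eq_det p hp hodd hinj D h11 rfl hLs (W \ T) hne (Or.inr (sdiff_mod_eight_three p hTW.1 h7 h5)),
            hιT T h5]
        · rw [if_pos h7, if_neg (fun h => hTW ⟨h.1, h.2.1⟩), if_pos h5, if_neg (fun h => hTW ⟨h.1, h.2.1⟩), zero_mul]
      · rw [if_pos h7, if_neg (fun h => h5 h.2.2), if_neg h5]
    · by_cases h5 : (∏ i ∈ T, p i) % 8 = 5
      · rw [if_neg h7, if_pos h5, if_neg (fun h => h7 h.2.2), zero_mul]
      · rw [if_neg h7, if_neg h5]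
  have hswap : (∑ W : Finset (Fin k), (if (∏ i ∈ W, p i) % 8 = 7 then
        ∑ T : Finset (Fin k), (if T ⊆ W ∧ T ≠ W ∧ (∏ i ∈ T, p i) % 8 = 5 then
          ((L (2 * ∏ i ∈ Wᶜ, p i) : ℕ) : ZMod 2) * ((L (∏ i ∈ W \ T, p i) : ℕ) : ZMod 2) * ((ι (∏ i ∈ T, p i) : ℕ) : ZMod 2) else 0) else 0)) =
      ∑ W : Finset (Fin k), ∑ T : Finset (Fin k), (if (∏ i ∈ T, p i) % 8 = 5 then
        (if T ⊆ W ∧ T ≠ W ∧ (∏ i ∈ W, p i) % 8 = 7 then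
          (monskyMatrixEven (blockPrimes p Wᶜ)).det * (monskyMatrixOdd (blockPrimes p (W \ T))).det else 0) * FP T else 0) := by
    refine Finset.sum_congr rfl fun W _ => ?_
    rw [← Finset.sum_congr rfl (fun T _ => hterm W T)]
    by_cases h7 : (∏ i ∈ W, p i) % 8 = 7
    · simp only [if_pos h7]
    · simp only [if_neg h7, Finset.sum_const_zero]
  rw [hswap, Finset.sum_comm]
  refine Finset.sum_congr rfl fun T _ => ?_
  by_cases h5 : (∏ i ∈ T, p i) % 8 = 5
  · simp only [if_pos h5, ← Finset.sum_mul, hFP]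
  · simp only [if_neg h5, Finset.sum_const_zero]

end Summit.BirchSwinnertonDyer.PrintCf2.MoverAssembly

end
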